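import Summits.QuantumAdvantage.QuantumAdvantage.Theorems.CounterDialA

/-! # CounterDialB — part 2/2 of the landing twins of NODE «CounterDial» (decomp-qadv lens-2, generation 21)

Content of the node file verbatim (see `CounterDialA` for the node docstring): §5 the COUNTER-FORM DIAL (`lin`,
`CounterForm`, `StabCounter`, the pieces `CounterLoss3` / `NonCounterGenericLoss3`, `closes` BY NAME onto
`Theses.SparsityDial.DenseGenericLoss3`, `dense_iff_split`, saturation under row padding), §6 the certificates (every
window-counter family is counter-form; piece A alone decides every window-counter rung, in particular the tree's
`Theorems.BlindDial.FullPaleyCounterLoss3`, which is cited, not restated), §7 the CUBE family: certified dense and not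
counter-form at the zero gauge (`cube_not_counterForm_zero`, finite core `cube_core` by `decide`). -/

set_option linter.dupNamespace false
noncomputable section
open scoped Classical

namespace Summit.QuantumAdvantage.QuantumAdvantage.Theorems.CounterDial
open Finset
open Literature.Computability.QuantumComplexity Literature.Computability.QuantumComplexity.RingHLF
open Literature.Computability.MetaComplexity Literature.Computability.MetaComplexity.Smolensky
open Summit.QuantumAdvantage.AdviceFreeQNC0
open Summit.QuantumAdvantage.QuantumAdvantage.Theorems.AnchorDial (outB dev cN fz fz_apply orbL orbL_cons orbL_nil
  oddZeros_orbL zpar_orbL orbL_apply_of_far cN_orbL orbL_invol card_filter_orbL sh sgN win_iff gCond_iff_cN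
  orbF oddZeros_orbF orbF_apply_of_far card_filter_orbF three_counts card_odd_ge loss_shape_mono)
open Summit.QuantumAdvantage.QuantumAdvantage.Theorems.HolonomyDial (gCond tPoly tPoly_apply tPoly_mem xorP xorP_mem
  xorP_apply_bool indP indP_apply mono_singleton_apply)
open Summit.QuantumAdvantage.QuantumAdvantage.Theorems.StabilizerDial (apIdx apStrat apStrat_mem bitP bitP_apStrat pad
  pad_mem rel_pad_iff StabFew outB_pad_pad outB_pad_congr bitP_gsum gsum gsum_mem deg_gsum dev_congr)
open Summit.QuantumAdvantage.QuantumAdvantage.Theorems.SparsityDial (real_loss_of_frac stabFew_mono_mr one_le_logpow)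
open Summit.QuantumAdvantage.QuantumAdvantage.Theorems.ResponseDial (loddG loddG_mem wStrat wStrat_agree wStrat_mem
  WindowCounterLoss3 windowCounterLoss3_of_dense wStrat_in_dense_class mem_dev_apStrat dev_pad_zero)
open Summit.QuantumAdvantage.QuantumAdvantage.Theses.SparsityDial (DenseGenericLoss3)
open Summit.QuantumAdvantage.QuantumAdvantage.Theorems.BlindDial (loddG_apply loddG_congr mem_dev_wStrat_second
  mem_dev_wStrat_first apIdx_val_first fullPaleyW FullPaleyCounterLoss3)

variable {N : ℕ}

/-! ## §5  THE DIAL: counter form (special) versus not (generic residual) -/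

/-- the `Z₃`-linear READOUT of the cells with coefficient vector `v`: `Σ_i v_i x_i ∈ Z₃`. -/
def lin (v : Fin N → ZMod 3) (x : Fin N → Bool) : ZMod 3 := ∑ i, if x i then v i else 0

/-- COUNTER FORM: at every odd input, position `k` deviates from the canonical guess iff its counter `lin (a k)` lands
in the residue set `A k` — the deviation field is a family of LEVEL SETS OF `Z₃`-LINEAR FORMS (a semantic condition on
the field; every window-counter / antipodal family filed so far has it, §6). -/
def CounterForm (a : Fin N → Fin N → ZMod 3) (A : Fin N → Finset (ZMod 3)) (Q : Fin N → CubeFn (ZMod 3) N) :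
    Prop :=
  ∀ x : Fin N → Bool, OddZeros x → ∀ k : Fin N, k ∈ dev Q x ↔ lin (a k) x ∈ A k

/-- CHEAPLY COUNTER-FORM: after padding by stabilizer rows selected by polynomials of degree `≤ (log N)^e`
(the gauge of `StabFew`, SAME FORMAT, radius slot unused) the field is in counter form. -/
def StabCounter (e : ℕ) (P : Fin N → CubeFn (ZMod 3) N) : Prop :=
  ∃ s : Fin N → CubeFn (ZMod 3) N, (∀ i, s i ∈ lowDeg (ZMod 3) N ((Nat.log 2 N) ^ e)) ∧
    ∃ (a : Fin N → Fin N → ZMod 3) (A : Fin N → Finset (ZMod 3)), CounterForm a A (pad P s)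

/-- **A — the SPECIAL piece `CounterLoss3`**: dense (not stabilizer-few) AND cheaply counter-form ⟹ polynomial loss. -/
def CounterLoss3 : Prop :=
  ∃ a : ℕ, ∃ C : ℕ, ∀ c : ℕ, ∃ n₀ : ℕ, ∀ n ≥ n₀, ∀ P : Fin n → CubeFn (ZMod 3) n,
    (∀ i, P i ∈ lowDeg (ZMod 3) n ((Nat.log 2 n) ^ c)) →
      ¬ StabFew ((Nat.log 2 n) ^ a) 0 (c + 1) P → StabCounter (c + 1) P →
        ((univ.filter fun x : Fin n → Bool =>
            OddZeros x ∧ Rel x (fun i => decide (P i x = 1))).card : ℝ)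
          ≤ (1 - 1 / (n : ℝ) ^ C) * (2 : ℝ) ^ (n - 1)

/-- **B — the GENERIC piece (RESIDUAL) `NonCounterGenericLoss3`**: dense and NOT cheaply counter-form ⟹ loss. -/
def NonCounterGenericLoss3 : Prop :=
  ∃ a : ℕ, ∃ C : ℕ, ∀ c : ℕ, ∃ n₀ : ℕ, ∀ n ≥ n₀, ∀ P : Fin n → CubeFn (ZMod 3) n,
    (∀ i, P i ∈ lowDeg (ZMod 3) n ((Nat.log 2 n) ^ c)) →
      ¬ StabFew ((Nat.log 2 n) ^ a) 0 (c + 1) P → ¬ StabCounter (c + 1) P →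
        ((univ.filter fun x : Fin n → Bool =>
            OddZeros x ∧ Rel x (fun i => decide (P i x = 1))).card : ℝ)
          ≤ (1 - 1 / (n : ℝ) ^ C) * (2 : ℝ) ^ (n - 1)

/-- **`closes`: A → B → DenseGenericLoss3** (by cases on `StabCounter (c+1) P`; `a, C, n₀ := max`). -/
theorem closes (hA : CounterLoss3) (hB : NonCounterGenericLoss3) : DenseGenericLoss3 := by
  obtain ⟨a₁, C₁, h₁⟩ := hA
  obtain ⟨a₂, C₂, h₂⟩ := hB
  refine ⟨max a₁ a₂, max C₁ C₂, fun c => ?_⟩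
  obtain ⟨n₁, hn₁⟩ := h₁ c
  obtain ⟨n₂, hn₂⟩ := h₂ c
  refine ⟨max (max n₁ n₂) 2, fun n hn P hP hgen => ?_⟩
  have hn2 : 2 ≤ n := le_trans (le_max_right _ _) hn
  have hn12 : max n₁ n₂ ≤ n := le_trans (le_max_left _ _) hn
  have hL : 1 ≤ Nat.log 2 n := Nat.le_log_of_pow_le (by norm_num) (by simpa using hn2)
  have hg₁ : ¬ StabFew ((Nat.log 2 n) ^ a₁) 0 (c + 1) P := fun h =>
    hgen (stabFew_mono_mr (Nat.pow_le_pow_right hL (le_max_left _ _)) (one_le_logpow hn2 a₁) le_rfl h)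
  have hg₂ : ¬ StabFew ((Nat.log 2 n) ^ a₂) 0 (c + 1) P := fun h =>
    hgen (stabFew_mono_mr (Nat.pow_le_pow_right hL (le_max_right _ _)) (one_le_logpow hn2 a₂) le_rfl h)
  by_cases hc : StabCounter (c + 1) P
  · exact loss_shape_mono (by omega) (le_max_left _ _) _ _ (by positivity)
      (hn₁ n (le_trans (le_max_left _ _) hn12) P hP hg₁ hc)
  · exact loss_shape_mono (by omega) (le_max_right _ _) _ _ (by positivity)
      (hn₂ n (le_trans (le_max_right _ _) hn12) P hP hg₂ hc)

/-- N-test, piece A: `DenseGenericLoss3 → CounterLoss3` (restriction). -/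
theorem counter_of_dense (hD : DenseGenericLoss3) : CounterLoss3 := by
  obtain ⟨a, C, h⟩ := hD
  refine ⟨a, C, fun c => ?_⟩
  obtain ⟨n₀, hn₀⟩ := h c
  exact ⟨n₀, fun n hn P hP hgen _ => hn₀ n hn P hP hgen⟩

/-- N-test, piece B: `DenseGenericLoss3 → NonCounterGenericLoss3` (restriction). -/
theorem nonCounter_of_dense (hD : DenseGenericLoss3) : NonCounterGenericLoss3 := by
  obtain ⟨a, C, h⟩ := hD
  refine ⟨a, C, fun c => ?_⟩
  obtain ⟨n₀, hn₀⟩ := h c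
  exact ⟨n₀, fun n hn P hP hgen _ => hn₀ n hn P hP hgen⟩

/-- EXACTNESS of the split: `D ↔ A ∧ B`. -/
theorem dense_iff_split : DenseGenericLoss3 ↔ (CounterLoss3 ∧ NonCounterGenericLoss3) :=
  ⟨fun h => ⟨counter_of_dense h, nonCounter_of_dense h⟩, fun h => closes h.1 h.2⟩

/-- ROW-PADDING TEST, direction 1: a strategy one of whose cheap pads is cheaply counter-form is itself cheaply
counter-form (one notch up) — the predicate is SATURATED under the gauge, so B is not `≡ D` by padding. -/
theorem stabCounter_of_stabCounter_pad (hN : 16 ≤ N) {e₀ e : ℕ} (he : e₀ ≤ e) {P s₀ : Fin N → CubeFn (ZMod 3) N}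
    (hs₀ : ∀ i, s₀ i ∈ lowDeg (ZMod 3) N ((Nat.log 2 N) ^ e₀)) (h : StabCounter e (pad P s₀)) :
    StabCounter (e + 1) P := by
  obtain ⟨s, hs, a, A, hF⟩ := h
  refine ⟨gsum s₀ s, fun i => lowDeg_mono (deg_gsum hN he) (gsum_mem hs₀ hs i), a, A, fun x hx k => ?_⟩
  rw [← dev_congr (fun x => outB_pad_pad P s₀ s x) x]
  exact hF x hx k

/-- ROW-PADDING TEST, direction 2: padding a cheaply counter-form strategy keeps it cheaply counter-form. -/
theorem stabCounter_pad_of_stabCounter (hN : 16 ≤ N) {e₀ e : ℕ} (he : e₀ ≤ e) {P s₀ : Fin N → CubeFn (ZMod 3) N}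
    (hs₀ : ∀ i, s₀ i ∈ lowDeg (ZMod 3) N ((Nat.log 2 N) ^ e₀)) (h : StabCounter e P) :
    StabCounter (e + 1) (pad P s₀) := by
  obtain ⟨s, hs, a, A, hF⟩ := h
  refine ⟨gsum s₀ s, fun i => lowDeg_mono (deg_gsum hN he) (gsum_mem hs₀ hs i), a, A, fun x hx k => ?_⟩
  have e1 : ∀ x, outB (pad (pad P s₀) (gsum s₀ s)) x = outB (pad P s) x := fun x => by
    rw [outB_pad_pad]
    exact outB_pad_congr (fun i x => by
      rw [bitP_gsum, bitP_gsum, ← Bool.xor_assoc, Bool.xor_self, Bool.false_xor]) P x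
  rw [dev_congr e1 x]
  exact hF x hx k

/-! ## §6  Certificates: the named dense families are counter-form; A alone decides every window-counter rung -/

/-- `lin` of a `0/1` indicator coefficient vector is the window sum. -/
theorem lin_indicator (S : Finset (Fin N)) (x : Fin N → Bool) :
    lin (fun i => if i ∈ S then 1 else 0) x = ∑ i ∈ S, (if x i then (1 : ZMod 3) else 0) := by
  have h : ∀ i : Fin N, (if x i then (if i ∈ S then (1 : ZMod 3) else 0) else 0) =
      if i ∈ S then (if x i then 1 else 0) else 0 := fun i => by split_ifs <;> rfl
  unfold lin
  rw [sum_congr rfl fun i _ => h i, sum_ite_mem, univ_inter]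

/-- `lin` of a single-cell indicator reads that cell. -/
theorem lin_single (j : Fin N) (x : Fin N → Bool) :
    lin (fun i => if i = j then 1 else 0) x = if x j then (1 : ZMod 3) else 0 := by
  unfold lin
  rw [sum_eq_single j (fun i _ hij => by simp [hij]) (fun h => absurd (mem_univ j) h)]
  simp

/-- the coefficients and residue sets certifying that a window-counter family is in counter form. -/
def wCoef (W : Fin N → Finset (Fin N)) (k i : Fin N) : ZMod 3 :=
  if 1 ≤ k.val ∧ k.val < N / 2 then (if i = apIdx k then 1 else 0) else (if i ∈ W k then 1 else 0)

/-- (see `wCoef`) -/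
def wRes (N : ℕ) (k : Fin N) : Finset (ZMod 3) := if 1 ≤ k.val ∧ k.val < N / 2 then {1} else {0}

/-- every window-counter field is in counter form at the zero gauge (pointer counters on the first half-cycle, window sums on the rest). -/
theorem wStrat_counterForm (W : Fin N → Finset (Fin N)) :
    CounterForm (wCoef W) (wRes N) (fun i : Fin N => wStrat W i) := by
  intro x _ k
  by_cases hk : 1 ≤ k.val ∧ k.val < N / 2
  · have hc : wCoef W k = fun i => if i = apIdx k then 1 else 0 := funext fun i => by simp [wCoef, hk]
    rw [mem_dev_wStrat_first W x k hk, hc, lin_single]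
    simp only [wRes, if_pos hk, mem_singleton]
    generalize x (apIdx k) = t
    cases t <;> decide
  · have hc : wCoef W k = fun i => if i ∈ W k then 1 else 0 := funext fun i => by simp [wCoef, hk]
    rw [mem_dev_wStrat_second W x k hk, hc, lin_indicator, ← loddG_apply]
    simp only [wRes, if_neg hk, mem_singleton, decide_eq_true_eq]

/-- every window-counter family is cheaply counter-form (zero gauge), at every exponent. -/
theorem wStrat_stabCounter (W : Fin N → Finset (Fin N)) (e : ℕ) : StabCounter e (fun i : Fin N => wStrat W i) :=
  ⟨fun _ => 0, fun _ => Submodule.zero_mem _, wCoef W, wRes N, fun x hx k => by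
    rw [dev_pad_zero]; exact wStrat_counterForm W x hx k⟩

/-- the antipodal family is cheaply counter-form. -/
theorem apStrat_stabCounter (e : ℕ) : StabCounter e (fun i : Fin N => apStrat i) :=
  ⟨fun _ => 0, fun _ => Submodule.zero_mem _, fun k i => if i = apIdx k then 1 else 0, fun _ => {1},
    fun x _ k => by
      rw [dev_pad_zero, show (k ∈ dev (fun i : Fin N => apStrat i) x) = (x (apIdx k) = true) from
        propext (by have h := mem_dev_apStrat x k; exact h), lin_single, mem_singleton]
      cases x (apIdx k) <;> decide⟩

/-- **piece A ALONE decides every window-counter rung** (the families are dense by `wStrat_in_dense_class` and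
counter-form by `wStrat_stabCounter`). -/
theorem windowCounterLoss3_of_counterLoss (W : (n : ℕ) → Fin n → Finset (Fin n)) (hA : CounterLoss3) :
    WindowCounterLoss3 W := by
  obtain ⟨a, C, h⟩ := hA
  obtain ⟨n₁, hn₁⟩ := h 1
  obtain ⟨n₂, hn₂⟩ := wStrat_in_dense_class W a 1 le_rfl
  refine ⟨C, max n₁ n₂, fun n hn => ?_⟩
  obtain ⟨hdeg, hgen⟩ := hn₂ n (le_trans (le_max_right _ _) hn)
  exact hn₁ n (le_trans (le_max_left _ _) hn) _ hdeg hgen (wStrat_stabCounter (W n) 2)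


/-- piece A alone decides the full-Paley rung (tree `Theorems.BlindDial.FullPaleyCounterLoss3`). -/
theorem fullPaley_of_counterLoss (hA : CounterLoss3) : FullPaleyCounterLoss3 :=
  windowCounterLoss3_of_counterLoss fullPaleyW hA

/-- `D` decides the full-Paley rung (by name). -/
theorem fullPaley_of_dense (hD : DenseGenericLoss3) : FullPaleyCounterLoss3 :=
  windowCounterLoss3_of_dense fullPaleyW hD

/-- … while the PUNCHED full-Paley family (four cells removed from every window) is decided by §4. -/
theorem punchedFullPaleyCounterLoss3 : WindowCounterLoss3 (punch fullPaleyW) := punchedCounterLoss3 fullPaleyW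


/-! ## §7  The dial cuts INSIDE the dense class: a dense degree-5 family that is NOT counter-form (zero gauge) -/

/-- the three cells `1, 2, 3`. -/
def cube3 (N : ℕ) : Finset (Fin N) := univ.filter fun i => 1 ≤ i.val ∧ i.val ≤ 3

/-- `cube3` has at most three cells. -/
theorem cube3_card_le : (cube3 N).card ≤ 3 := by
  have h : (cube3 N).card ≤ (({1, 2, 3} : Finset ℕ)).card :=
    card_le_card_of_injOn (fun i : Fin N => i.val)
      (fun i hi => by
        have h := (mem_filter.1 (mem_coe.1 hi)).2
        simp only [coe_insert, coe_singleton, Set.mem_insert_iff, Set.mem_singleton_iff]; omega)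
      (fun i _ j _ hij => Fin.ext hij)
  exact le_trans h (by decide)

/-- the CUBE family: antipodal pointers on the first half-cycle (certified density); every other position toggles the
canonical guess by the CONJUNCTION `x₁ ∧ x₂ ∧ x₃` — a reader whose level sets are not those of a `Z₃`-linear form. -/
def cubeStrat (k : Fin N) : CubeFn (ZMod 3) N :=
  if 1 ≤ k.val ∧ k.val < N / 2 then apStrat k else xorP (tPoly k) (mono (ZMod 3) (cube3 N))

/-- the cube family agrees with the antipodal family on the first half-cycle. -/
theorem cubeStrat_agree (n : ℕ) (k : Fin n) (h1 : 1 ≤ k.val) (h2 : k.val < n / 2) : cubeStrat k = apStrat k := by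
  unfold cubeStrat; rw [if_pos ⟨h1, h2⟩]

/-- the cube family has degree `≤ 5`. -/
theorem cubeStrat_mem5 (k : Fin N) : cubeStrat k ∈ lowDeg (ZMod 3) N 5 := by
  unfold cubeStrat
  split_ifs
  · exact lowDeg_mono (by norm_num) (apStrat_mem k)
  · have h : xorP (tPoly k) (mono (ZMod 3) (cube3 N)) ∈ lowDeg (ZMod 3) N (2 + 3) :=
      xorP_mem (tPoly_mem k) (mono_mem_lowDeg cube3_card_le)
    exact lowDeg_mono (show 2 + 3 ≤ 5 by norm_num) h

/-- the cube family is in the dense class `(c ≥ 1)`: degree `≤ (log n)^c` and not stabilizer-few, eventually. -/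
theorem cube_in_dense_class (a c : ℕ) (hc : 1 ≤ c) :
    ∃ n₀ : ℕ, ∀ n ≥ n₀, (∀ i : Fin n, cubeStrat i ∈ lowDeg (ZMod 3) n ((Nat.log 2 n) ^ c)) ∧
      ¬ StabFew ((Nat.log 2 n) ^ a) 0 (c + 1) (fun j : Fin n => cubeStrat j) := by
  obtain ⟨n₀, hn₀⟩ := Summit.QuantumAdvantage.QuantumAdvantage.Theorems.ResponseDial.not_polylogSparse_of_agree
    (fun n (j : Fin n) => cubeStrat j) (fun n j h1 h2 => cubeStrat_agree n j h1 h2) a (c + 1)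
  refine ⟨max n₀ 32, fun n hn => ⟨fun i => lowDeg_mono ?_ (cubeStrat_mem5 i), hn₀ n (le_trans (le_max_left _ _) hn)⟩⟩
  have h32 : 2 ^ 5 ≤ n := le_trans (le_max_right _ _) hn
  have hL : 5 ≤ Nat.log 2 n := Nat.le_log_of_pow_le (by norm_num) h32
  calc 5 ≤ Nat.log 2 n := hL
    _ = (Nat.log 2 n) ^ 1 := (pow_one _).symm
    _ ≤ (Nat.log 2 n) ^ c := Nat.pow_le_pow_right (by omega) hc

/-- deviation of the cube family at a position outside the first half-cycle is the conjunction `x₁ ∧ x₂ ∧ x₃`. -/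
theorem mem_dev_cube_second (y : Fin N → Bool) (k : Fin N) (hk : ¬ (1 ≤ k.val ∧ k.val < N / 2)) :
    k ∈ dev (fun i : Fin N => cubeStrat i) y ↔ decide (∀ i ∈ cube3 N, y i = true) = true := by
  have happ : cubeStrat k y = if xor (tGuess y k) (decide (∀ i ∈ cube3 N, y i = true)) then 1 else 0 := by
    unfold cubeStrat; rw [if_neg hk]
    exact xorP_apply_bool _ _ y _ _ (tPoly_apply k y)
      (by rw [mono_apply]; by_cases h : (∀ i ∈ cube3 N, y i = true) <;> simp [h])
  simp only [Summit.QuantumAdvantage.QuantumAdvantage.Theorems.AnchorDial.dev, mem_filter, mem_univ, true_and, happ]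
  generalize tGuess y k = t; generalize decide (∀ i ∈ cube3 N, y i = true) = q
  cases t <;> cases q <;> decide

/-- the test inputs: `ξ` on the cells `0 … 4`, `true` elsewhere. -/
def xloc (ξ : Fin 5 → Bool) (i : Fin N) : Bool := if h : i.val < 5 then ξ ⟨i.val, h⟩ else true

/-- `xloc` on the five local cells. -/
theorem xloc_castLE (h5 : 5 ≤ N) (ξ : Fin 5 → Bool) (j : Fin 5) : xloc ξ (Fin.castLE h5 j) = ξ j := by
  simp [xloc, j.isLt]

/-- the zero count of `xloc ξ` is the local zero count. -/
theorem zeros_xloc (h5 : 5 ≤ N) (ξ : Fin 5 → Bool) :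
    (univ.filter fun i : Fin N => xloc ξ i = false) =
      (univ.filter fun j : Fin 5 => ξ j = false).map (Fin.castLEEmb h5) := by
  ext i
  simp only [mem_filter, mem_univ, true_and, mem_map]
  constructor
  · intro hi
    by_cases h : i.val < 5
    · refine ⟨⟨i.val, h⟩, by simpa [xloc, h] using hi, Fin.ext (by simp)⟩
    · simp [xloc, h] at hi
  · rintro ⟨j, hj, rfl⟩
    rw [Fin.castLEEmb_apply, xloc_castLE]; exact hj

/-- `xloc ξ` is odd iff the local zero count is odd. -/
theorem oddZeros_xloc (h5 : 5 ≤ N) (ξ : Fin 5 → Bool) :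
    OddZeros (xloc ξ : Fin N → Bool) ↔ (univ.filter fun j : Fin 5 => ξ j = false).card % 2 = 1 := by
  unfold OddZeros; rw [zeros_xloc h5, card_map]

/-- a `Z₃`-linear form evaluated on `xloc ξ` = a constant plus the five local terms. -/
theorem lin_xloc (h5 : 5 ≤ N) (v : Fin N → ZMod 3) (ξ : Fin 5 → Bool) :
    lin v (xloc ξ) = (∑ i ∈ univ.filter (fun i : Fin N => ¬ i.val < 5), v i) +
      ∑ j : Fin 5, (if ξ j then v (Fin.castLE h5 j) else 0) := by
  unfold lin
  rw [← sum_filter_add_sum_filter_not univ (fun i : Fin N => i.val < 5), add_comm]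
  congr 1
  · refine sum_congr rfl fun i hi => ?_
    have hi' : ¬ i.val < 5 := (mem_filter.1 hi).2
    simp [xloc, hi']
  · have e : univ.filter (fun i : Fin N => i.val < 5) = (univ : Finset (Fin 5)).map (Fin.castLEEmb h5) := by
      ext i
      simp only [mem_filter, mem_univ, true_and, mem_map]
      constructor
      · intro hi; exact ⟨⟨i.val, hi⟩, Fin.ext (by simp)⟩
      · rintro ⟨j, rfl⟩; simp [j.isLt]
    rw [e, sum_map]
    refine sum_congr rfl fun j _ => ?_
    rw [Fin.castLEEmb_apply, xloc_castLE]

/-- the conjunction `x₁ ∧ x₂ ∧ x₃` on `xloc ξ`. -/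
theorem cube3_xloc (h5 : 5 ≤ N) (ξ : Fin 5 → Bool) :
    (∀ i ∈ cube3 N, xloc ξ i = true) ↔
      (ξ ⟨1, by norm_num⟩ && ξ ⟨2, by norm_num⟩ && ξ ⟨3, by norm_num⟩) = true := by
  rw [Bool.and_eq_true, Bool.and_eq_true]
  constructor
  · intro h
    refine ⟨⟨?_, ?_⟩, ?_⟩
    · have := h ⟨1, by omega⟩ (mem_filter.2 ⟨mem_univ _, by simp⟩); simpa [xloc] using this
    · have := h ⟨2, by omega⟩ (mem_filter.2 ⟨mem_univ _, by simp⟩); simpa [xloc] using this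
    · have := h ⟨3, by omega⟩ (mem_filter.2 ⟨mem_univ _, by simp⟩); simpa [xloc] using this
  · rintro ⟨⟨h1, h2⟩, h3⟩ i hi
    have hi' := (mem_filter.1 hi).2
    have hlt : i.val < 5 := by omega
    rw [show i = Fin.castLE h5 ⟨i.val, hlt⟩ from Fin.ext (by simp), xloc_castLE]
    rcases (by omega : i.val = 1 ∨ i.val = 2 ∨ i.val = 3) with h | h | h
    · rw [show (⟨i.val, hlt⟩ : Fin 5) = ⟨1, by norm_num⟩ from Fin.ext h]; exact h1
    · rw [show (⟨i.val, hlt⟩ : Fin 5) = ⟨2, by norm_num⟩ from Fin.ext h]; exact h2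
    · rw [show (⟨i.val, hlt⟩ : Fin 5) = ⟨3, by norm_num⟩ from Fin.ext h]; exact h3

/-- residue-set membership as a boolean selector. -/
def bsel (A₀ A₁ A₂ : Bool) (r : ZMod 3) : Bool := if r = 0 then A₀ else if r = 1 then A₁ else A₂

/-- membership of a residue in a set of residues, as the Boolean selector `bsel`. -/
theorem mem_iff_bsel (A : Finset (ZMod 3)) (r : ZMod 3) :
    r ∈ A ↔ bsel (decide ((0 : ZMod 3) ∈ A)) (decide ((1 : ZMod 3) ∈ A)) (decide ((2 : ZMod 3) ∈ A)) r = true := by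
  have h3 : ∀ r : ZMod 3, r ≠ 0 → r ≠ 1 → r = 2 := by decide
  unfold bsel
  split_ifs with h0 h1
  · subst h0; simp
  · subst h1; simp
  · rw [h3 r h0 h1]; simp

/-- **the cube core** (a finite check): for all coefficients on the five local cells, every constant term and every
residue set, some assignment with an odd number of local zeros separates the conjunction `ξ₁ ∧ ξ₂ ∧ ξ₃` from the
level set of the linear form. -/
theorem cube_core : ∀ δ₀ α β γ δ₄ ρ : ZMod 3, ∀ A₀ A₁ A₂ : Bool, ∃ ξ₀ ξ₁ ξ₂ ξ₃ ξ₄ : Bool,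
    ((!ξ₀).toNat + (!ξ₁).toNat + (!ξ₂).toNat + (!ξ₃).toNat + (!ξ₄).toNat) % 2 = 1 ∧
      (ξ₁ && ξ₂ && ξ₃) ≠ bsel A₀ A₁ A₂ (ρ + ((if ξ₀ then δ₀ else 0) + (if ξ₁ then α else 0) +
        (if ξ₂ then β else 0) + (if ξ₃ then γ else 0) + (if ξ₄ then δ₄ else 0))) := by
  decide

/-- the number of `false` entries of a `Fin 5` vector as a sum. -/
theorem card_false_five (ξ : Fin 5 → Bool) :
    (univ.filter fun j : Fin 5 => ξ j = false).card =
      (!ξ 0).toNat + (!ξ 1).toNat + (!ξ 2).toNat + (!ξ 3).toNat + (!ξ 4).toNat := by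
  rw [card_filter, Fin.sum_univ_five]
  have h : ∀ b : Bool, (if b = false then 1 else 0) = (!b).toNat := by decide
  simp only [h]

/-- **the cube family is NOT in counter form at the zero gauge** (`N ≥ 6`). -/
theorem cube_not_counterForm (hN : 6 ≤ N) (a : Fin N → Fin N → ZMod 3) (A : Fin N → Finset (ZMod 3)) :
    ¬ CounterForm a A (pad (fun i : Fin N => cubeStrat i) (fun _ => 0)) := by
  intro hF
  have h5 : 5 ≤ N := by omega
  set k₀ : Fin N := ⟨N - 1, by omega⟩ with hk₀
  have hk : ¬ (1 ≤ k₀.val ∧ k₀.val < N / 2) := by simp only [hk₀]; omega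
  set v := a k₀ with hv
  set c : Fin 5 → Fin N := Fin.castLE h5 with hc
  set ρ : ZMod 3 := ∑ i ∈ univ.filter (fun i : Fin N => ¬ i.val < 5), v i with hρ
  obtain ⟨ξ₀, ξ₁, ξ₂, ξ₃, ξ₄, hpar, hne⟩ := cube_core (v (c 0)) (v (c 1)) (v (c 2)) (v (c 3)) (v (c 4)) ρ
    (decide ((0 : ZMod 3) ∈ A k₀)) (decide ((1 : ZMod 3) ∈ A k₀)) (decide ((2 : ZMod 3) ∈ A k₀))
  set ξ : Fin 5 → Bool := ![ξ₀, ξ₁, ξ₂, ξ₃, ξ₄] with hξ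
  have hodd : OddZeros (xloc ξ : Fin N → Bool) := by
    rw [oddZeros_xloc h5, card_false_five]; exact hpar
  have h := hF (xloc ξ) hodd k₀
  rw [dev_pad_zero, mem_dev_cube_second _ k₀ hk, decide_eq_true_iff, cube3_xloc h5, mem_iff_bsel,
    lin_xloc h5, Fin.sum_univ_five] at h
  apply hne
  rw [Bool.eq_iff_iff]
  exact h

/-- hence, for `N ≥ 6`, the cube family is not cheaply counter-form AT THE ZERO GAUGE (whether some non-zero cheap
gauge puts it in counter form is left open, as for every exemplar of a residual in this programme). -/
theorem cube_not_counterForm_zero (hN : 6 ≤ N) :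
    ¬ ∃ (a : Fin N → Fin N → ZMod 3) (A : Fin N → Finset (ZMod 3)),
      CounterForm a A (pad (fun i : Fin N => cubeStrat i) (fun _ => 0)) := by
  rintro ⟨a, A, h⟩; exact cube_not_counterForm hN a A h

end Summit.QuantumAdvantage.QuantumAdvantage.Theorems.CounterDial
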